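import Summits.ResolutionOfSingularities.ResolutionOfSingularities.Theorems.PurelyInseparableDim4ResConeDInfAssembly
import Summits.ResolutionOfSingularities.ResolutionOfSingularities.Theorems.PurelyInseparableDim4ResConeDInfEntryFrame
import Summits.ResolutionOfSingularities.ResolutionOfSingularities.Theorems.PurelyInseparableDim4ResConeDInfLoseStep
import Summits.ResolutionOfSingularities.ResolutionOfSingularities.Theorems.PurelyInseparableDim4ResConeLightPairTT
import HarnessLib
import HarnessLib.Audit.Tags

/-!
# Purely inseparable four-folds — the D∞ `(5,4)` BRANCH IS EMPTY and TAIL-D HOLDS, UNCONDITIONALLY: the heavy line's three laws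
# E₄ / K₄ / L₄ are tree theorems, so the assembly closes (cell `res-dim4-pi`, K2(p) lane, slice C `(5,4)`; CARD I-1-9/I-1-10
# «THE HEAVY LINE» of res-dim4-idea-1 g8, interface of record HOLDER WORD g4-4)

[OURS · counted 0 · cell `res-dim4-pi` · K2(p) lane (holder res-dim4-p-12 g4); one-liners over the tree: the instantiated assembly
`ResCone.no_dInf_tail_four_five_of_EL` (res-dim4-p-7 g5, p707409; KEEP-H law K₄ `ResCone.dInf_stub_keep` p707218 inside), the entry
frame E₄ `ResCone.stub_entryFrame₄` (res-dim4-p-9 g4, p707534), the LOSE-H law L₄ `ResCone.dInf_stub_lose` (res-dim4-p-2 g5,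
`…ResConeDInfLoseStep`), over res-dim4-p-11 g5's supercritical Φ-laws (`…PhiLineSupercritical(Label)`), and res-dim4-p-3 g4's
light-pair kill `ResCone.no_light_pair_tail_four_five` (`…ResConeLightPairTT`); kernel hand res-dim4-p-7 g5.]  Nothing here proves
K2(5) (`RidgeBudget.NoAboveFloorTrap 5 5`), `NoIsolatedTrap 5 5` or resolution of singularities in dimension ≥ 4 / characteristic `p`
— NOT proved; what is proved is the emptiness of two sub-classes of OUR frame's hypothetical infinite chains (`Step0 5` witnessed
isolated chains of `z⁵ = F(x₁..x₄)` states, constant shade `4`, `e_G ≡ 2`).  AI kernel work, weaker than expert review.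

* **`no_dInf_tail_four_five`** — on a witnessed isolated above-floor `Step0 5` chain with `x^{r₀} ∣ F₀`, shade `≡ 4` and `e_G ≡ 2` from
  `k₀`, the D∞ branch (from some `k₁ ≥ k₀`: one weight-`2` letter, the others `≤ 1`, `|r| ∈ {2,3}`) is EMPTY: `no_dInf_tail_four_five_of_EL`
  with `hE := stub_entryFrame₄`, `hL := dInf_stub_lose`;
* **`no_shadeFour_binaryCone_tail_five`** — hence NO such chain at all (light-pair branch: `no_light_pair_tail_four_five`; D∞ branch: the
  above; W₄ `four_weights_dichotomy`);
* **`tailD_four_five`** — the same, quantified over the field: the TAIL-D block of the slice-C socket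
  (`…ResConeSliceCSocket.noAboveFloorTrap_five_iff_no_binaryCone_tails`, right conjunct) VERBATIM;
* **`dInf_representation`** — the hN4-D binder of `ResCone.no_dInf_tail_of_representation` (`…RepresentationSockets` p703603), character
  for character (vacuously) — the re-presentation-free discharge of K2(5)'s last named input of LEDGER v8.3.
[cite: CossartJannsenSaito2020, Thm. 3.14, Lemma 13.4 (3), Thm. 13.7] [cite: CossartPiltant2008, (16), Prop. 4.2]
bears_on: LADDER-RESOLUTION:D157-DOOR2 (res-dim4-pi · K2(p) · slice C `(5,4)` TAIL-D closed ‖ K).  Supports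
stmt-ResolutionOfSingularities-16155 (helper).
-/

set_option linter.dupNamespace false -- mandated namespace of this single-conjunct summit

noncomputable section

namespace Summit.ResolutionOfSingularities.ResolutionOfSingularities.Theorems.PIDim4

namespace ResCone

open MvPolynomial Finset
open Literature.AlgebraicGeometry.Resolution
open Literature.AlgebraicGeometry.Resolution.CentreBlowup
open Literature.AlgebraicGeometry.Resolution.Hauser2010
open Literature.AlgebraicGeometry.Resolution.HauserPerlega2019
open Literature.AlgebraicGeometry.Resolution.WeightedOrder

section Chain

variable {K : Type} [Field K] [CharP K 5] [DecidableEq K]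

/-- **THE D∞ `(5,4)` BRANCH IS EMPTY (heavy line, unconditional).**  Along a witnessed isolated above-floor `Step0 5` chain with
`x^{r₀} ∣ F₀`, constant shade `4` and `e_G ≡ 2` from `k₀`, the D∞ branch from `k₁ ≥ k₀` (one weight-`2` letter, the others `≤ 1`,
`2 ≤ |r_k| ≤ 3`) cannot exist: the carried heavy label (E₄ `stub_entryFrame₄` at a `(2,1)`-state, K₄ `dInf_stub_keep` with `βs`
strictly dropping at `(2)`-states, L₄ `dInf_stub_lose` with `βs` not rising at `(2,1)`-states) bounds the number of `(2)`-states,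
against W₄'s dock. [OURS] [cite: CossartJannsenSaito2020, Thm. 3.14, Lemma 13.4 (3), Thm. 13.7] -/
theorem no_dInf_tail_four_five {c : ℕ → State K} {j : ℕ → Fin 4} {b : ℕ → Fin 4 → K}
    (hc : ∀ k, IsIsolated 5 (c k).F ∧ Step0 5 (c k) (c (k + 1))) (hw : FreeTail.IsWitnessedChain 5 c j b)
    (hr0 : ∀ e ∈ (c 0).F.support, (c 0).r ≤ e) (hfloor : ∀ k, ordZero (c k).F ≠ 5) {k₀ : ℕ}
    (hshade : ∀ k, k₀ ≤ k → (c k).shade = ((4 : ℕ) : ℕ∞))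
    (he : ∀ k, k₀ ≤ k → Module.finrank K (resVertex (c k)) = 2) {k₁ : ℕ} (hk₁ : k₀ ≤ k₁)
    (hD : ∀ k, k₁ ≤ k → (∃ W, (c k).r W = 2 ∧ ∀ i, i ≠ W → (c k).r i ≤ 1) ∧
      (2 ≤ (c k).r.degree ∧ (c k).r.degree ≤ 3)) : False :=
  no_dInf_tail_four_five_of_EL hc hw hr0 hfloor hshade he hk₁ hD
    (fun _ hk h3 _ hW => stub_entryFrame₄ hc hw hr0 hfloor hshade he hk h3 hW)
    (dInf_stub_lose hc hw hr0 hfloor hshade he)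

/-- **NO SHADE-`4`, `e_G = 2` TAIL AT `p = 5` (both branches of W₄'s dichotomy).**  Along a witnessed isolated above-floor `Step0 5` chain
with `x^{r₀} ∣ F₀`, constant shade `4` and `e_G ≡ 2` from `k₀`: `False` — the light-pair branch by res-dim4-p-3 g4's
`no_light_pair_tail_four_five`, the D∞ branch by `no_dInf_tail_four_five`. [OURS] [cite: CossartJannsenSaito2020, Thm. 3.14] -/
theorem no_shadeFour_binaryCone_tail_five {c : ℕ → State K} {j : ℕ → Fin 4} {b : ℕ → Fin 4 → K}
    (hc : ∀ k, IsIsolated 5 (c k).F ∧ Step0 5 (c k) (c (k + 1))) (hw : FreeTail.IsWitnessedChain 5 c j b)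
    (hr0 : ∀ e ∈ (c 0).F.support, (c 0).r ≤ e) (hfloor : ∀ k, ordZero (c k).F ≠ 5) {k₀ : ℕ}
    (hshade : ∀ k, k₀ ≤ k → (c k).shade = ((4 : ℕ) : ℕ∞))
    (he : ∀ k, k₀ ≤ k → Module.finrank K (resVertex (c k)) = 2) : False :=
  tailD_four_five_of_lightPair_of_EL hc hw hr0 hfloor hshade he
    (fun hwt => no_light_pair_tail_four_five hc hw hr0 (fun k => by exact_mod_cast hfloor k) hshade he hwt)
    (fun _ hk h3 _ hW => stub_entryFrame₄ hc hw hr0 hfloor hshade he hk h3 hW)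
    (dInf_stub_lose hc hw hr0 hfloor hshade he)

end Chain

/-- **TAIL-D `(5,4)` — the slice-C socket's `d = 4` block, VERBATIM** (right conjunct of
`noAboveFloorTrap_five_iff_no_binaryCone_tails`, `…ResConeSliceCSocket`): over every field of characteristic `5`, no witnessed isolated
above-floor `Step0 5` chain with `x^{r₀} ∣ F₀` has constant shade `4` and `e_G ≡ 2` from some index on. [OURS]
[cite: CossartJannsenSaito2020, Thm. 3.14, Thm. 13.7] -/
theorem tailD_four_five : ∀ (K : Type) [Field K] [CharP K 5] [DecidableEq K],
    ∀ (c : ℕ → State K) (j : ℕ → Fin 4) (b : ℕ → Fin 4 → K),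
      (∀ k, IsIsolated 5 (c k).F ∧ Step0 5 (c k) (c (k + 1))) → FreeTail.IsWitnessedChain 5 c j b →
      (∀ e ∈ (c 0).F.support, (c 0).r ≤ e) → (∀ k, ordZero (c k).F ≠ (5 : ℕ)) →
      ∀ k₀ : ℕ, (∀ k, k₀ ≤ k → (c k).shade = ((4 : ℕ) : ℕ∞)) →
      (∀ k, k₀ ≤ k → Module.finrank K (resVertex (c k)) = 2) → False :=
  fun _ _ _ _ _ _ _ hc hw hr0 hfloor _ hshade he =>
    no_shadeFour_binaryCone_tail_five hc hw hr0 (fun k => by exact_mod_cast hfloor k) hshade he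

/-- **hN4-D IS A THEOREM** (vacuously): the D∞ `(5,4)` pair-confinement re-presentation binder of
`ResCone.no_dInf_tail_of_representation` (`…ResConeRepresentationSockets`, res-dim4-p-12 g4), character for character — there is no D∞
chain to re-present (`no_dInf_tail_four_five`). [OURS] [cite: CossartJannsenSaito2020, Thm. 3.14] -/
theorem dInf_representation {K : Type} [Field K] [CharP K 5] [DecidableEq K] :
    ∀ (c : ℕ → State K) (j : ℕ → Fin 4) (b : ℕ → Fin 4 → K),
      (∀ k, IsIsolated 5 (c k).F ∧ Step0 5 (c k) (c (k + 1))) → FreeTail.IsWitnessedChain 5 c j b →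
      (∀ e ∈ (c 0).F.support, (c 0).r ≤ e) → (∀ k, ordZero (c k).F ≠ (5 : ℕ)) →
      ∀ k₀ : ℕ, (∀ k, k₀ ≤ k → (c k).shade = ((4 : ℕ) : ℕ∞)) →
      (∀ k, k₀ ≤ k → Module.finrank K (resVertex (c k)) = 2) →
      ∀ k₁ : ℕ, k₀ ≤ k₁ → (∀ k, k₁ ≤ k → (∃ W, (c k).r W = 2 ∧ ∀ i, i ≠ W → (c k).r i ≤ 1) ∧
        (2 ≤ (c k).r.degree ∧ (c k).r.degree ≤ 3)) →
      ∃ (c' : ℕ → State K) (j' : ℕ → Fin 4) (b' : ℕ → Fin 4 → K) (k₀' : ℕ) (a a' : Fin 4),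
        (∀ k, IsIsolated 5 (c' k).F ∧ Step0 5 (c' k) (c' (k + 1))) ∧ FreeTail.IsWitnessedChain 5 c' j' b' ∧
        (∀ e ∈ (c' 0).F.support, (c' 0).r ≤ e) ∧ (∀ k, ordZero (c' k).F ≠ (5 : ℕ)) ∧
        (∀ k, k₀' ≤ k → (c' k).shade = ((4 : ℕ) : ℕ∞)) ∧
        (∀ k, k₀' ≤ k → Module.finrank K (resVertex (c' k)) = 2) ∧ a ≠ a' ∧
        (∀ k, k₀' ≤ k → (j' k = a ∨ j' k = a')) ∧
        (∀ k, k₀' ≤ k → ∀ i, i ≠ a → i ≠ a' → (c' k).r i = 0) :=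
  fun _ _ _ hc hw hr0 hfloor _ hshade he _ hk₁ hD =>
    (no_dInf_tail_four_five hc hw hr0 (fun k => by exact_mod_cast hfloor k) hshade he hk₁ hD).elim

end ResCone

end Summit.ResolutionOfSingularities.ResolutionOfSingularities.Theorems.PIDim4

end
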